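/-
Origin: expansion seat `planner-pub-hodgecm-pv03-0`, handover 2026-08-18 (`HOME/pub-hodgecm-pv03/lean/Pv03/PerL34/BallSpansSmoke.lean`, md5 777f3508, 184 lines);
landed by the gen-6 packager in gate run 22 as `HodgeCM/PerL34/BallSpansSmoke.lean` (import ^import Pv[0-9]+\.PerL34\.→import HodgeCM.PerL34. ×1).
-/
/-
Origin: HOME/pub-hodgecm-pv03/lean/Pv03/PerL34/BallSpansSmoke.lean — session planner-pub-hodgecm-pv03-0 (unit
pub-hodgecm-pv03, DAG-NODE PROVER #03, node N33 holder).  Intended final place (OPTIONAL smoke file, additive):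
`HodgeCM/PerL34/BallSpansSmoke.lean`, after `HodgeCM/PerL34/BallFrame.lean` (pv03 v7; here `import Pv03.PerL34.BallFrame`
— PACKAGER: landed name).  KERNEL: nothing cited, nothing asserted.
-/
import Summits.HodgeConjecture.HodgeCM.PerL34.BallFrame

/-!
# Satisfiability of the non-dictionary inputs of seam S1 (`BallSpans.BallSpanStepsInput`)

A vacuity guard for the seam-S1 constructor `BallSpans.LineSpans.n33c_ball` (cf. GAPS pv14-C2 / carver-g2
`SeamVacuity`): the group-level inputs it consumes — pv02's five INPUT Props `LeftInvariant`, `CompactInvariant`,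
`FiniteStable`, `UHolomorphic`, `SomeNonzero` of `P43_lineSpan.LineSpanData`, the dictionary sentence `HolFromBall`
(equivalently the intrinsic `BallFrame.HolFrame`) and `Dense Δ` — are JOINTLY SATISFIABLE over the canonical ball
model, by an explicit elementary witness:

* `G_c := Unit`, `G_f := U(2,1)` (discrete copy), `Γ :=` the graph `{(g, (), g)}` (so `Δ = U(2,1)`, dense);
* `Hol :=` the continuous right-`K`-equivariant `ℂ²`-valued functions on `U(2,1)` (`BallFrame.IsFrameFn`);
* one index per type, `Θ_i(χ)[𝔭₊] := {F_ψ : ψ ∈ Hol}`, `F_ψ(g, c, h) := ψ(h⁻¹ g)` — left-`Γ`-invariant, constant in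
  `c`, stable under right translation by `G_f`, with `u_{F_ψ} = ψ`, and non-zero (it contains the frame reading `R u₀`
  of the constant form `u₀ = e₀`).

Hence the kernel theorem `n33c_ball` fires on a concrete instance (`smoke_n33c`), and none of the hypotheses it lists
is contradictory on its own or jointly.  (The three dictionary Props `Dict_thetaClass₀/₁`, `Dict_cupWedge` speak
about a `ThetaModel` and are not exercised here.)  Nothing in this file is used by the main chain.
-/

set_option autoImplicit false

noncomputable section

open Complex

namespace HodgeCM
namespace PerL34
namespace BallSpansSmoke

open HodgeCM.PerL34.BallModel HodgeCM.PerL34.BallSpans HodgeCM.PerL34.BallFrame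
  HodgeCM.PerL34.WedgeNonvanishing HodgeCM.PerL34.P43

/-- `Hol` of the witness: continuous right-`K`-equivariant `ℂ²`-valued functions on `U(2,1)`. -/
def holSub : Submodule ℂ (U21 → (Fin 2 → ℂ)) where
  carrier := {φ | Continuous φ ∧ IsFrameFn φ}
  add_mem' := by
    rintro φ ψ ⟨hφc, hφf⟩ ⟨hψc, hψf⟩
    refine ⟨hφc.add hψc, fun g k hk => ?_⟩
    simp only [Pi.add_apply, hφf g k hk, hψf g k hk, map_add]
  zero_mem' := by
    refine ⟨continuous_const, fun g k _ => ?_⟩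
    simp only [Pi.zero_apply, map_zero]
  smul_mem' := by
    rintro c φ ⟨hφc, hφf⟩
    refine ⟨hφc.const_smul c, fun g k hk => ?_⟩
    simp only [Pi.smul_apply, hφf g k hk, map_smul]

/-- (Ported verbatim from the HodgeCMPerL package; no docstring in the source.) -/
theorem mem_holSub {φ : U21 → (Fin 2 → ℂ)} : φ ∈ holSub ↔ Continuous φ ∧ IsFrameFn φ := Iff.rfl

/-- Left translates of elements of `Hol` are in `Hol` (the frame condition is a condition on the right). -/
theorem lTransl_mem_holSub (h : U21) {φ : U21 → (Fin 2 → ℂ)} (hφ : φ ∈ holSub) : lTransl h φ ∈ holSub := by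
  obtain ⟨hc, hf⟩ := hφ
  refine ⟨hc.comp (continuous_const_mul h), fun g k hk => ?_⟩
  simp only [lTransl_apply, ← mul_assoc]
  exact hf (h * g) k hk

/-- `ψ ↦ F_ψ`, `F_ψ(g, c, h) := ψ(h⁻¹ g)`. -/
def lift : (U21 → (Fin 2 → ℂ)) →ₗ[ℂ] (U21 × Unit × U21 → (Fin 2 → ℂ)) where
  toFun ψ x := ψ (x.2.2⁻¹ * x.1)
  map_add' _ _ := rfl
  map_smul' _ _ := rfl

/-- (Ported verbatim from the HodgeCMPerL package; no docstring in the source.) -/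
@[simp] theorem lift_apply (ψ : U21 → (Fin 2 → ℂ)) (x : U21 × Unit × U21) : lift ψ x = ψ (x.2.2⁻¹ * x.1) := rfl

/-- The graph subgroup `{(g, (), g)}` of `U(2,1) × Unit × U(2,1)`. -/
def graph : Subgroup (U21 × Unit × U21) where
  carrier := {x | x.2.2 = x.1}
  mul_mem' := by
    rintro ⟨a, b, c⟩ ⟨d, e, f⟩ (h1 : c = a) (h2 : f = d)
    show c * f = a * d
    rw [h1, h2]
  one_mem' := rfl
  inv_mem' := by
    rintro ⟨a, b, c⟩ (h : c = a)
    show c⁻¹ = a⁻¹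
    rw [h]

/-- (Ported verbatim from the HodgeCMPerL package; no docstring in the source.) -/
theorem mem_graph {x : U21 × Unit × U21} : x ∈ graph ↔ x.2.2 = x.1 := Iff.rfl

/-- The witness (reducible, so that its fields compute by unification). -/
abbrev witness : LineSpans where
  Gc := Unit
  Gf := U21
  Γ := graph
  X := fun _ => Unit
  ThetaP := fun _ _ => holSub.map lift
  Hol := holSub

/-- (Ported verbatim from the HodgeCMPerL package; no docstring in the source.) -/
theorem uEval_lift (ψ : U21 → (Fin 2 → ℂ)) :
    (uEval : (U21 × Unit × U21 → (Fin 2 → ℂ)) →ₗ[ℂ] (U21 → (Fin 2 → ℂ))) (lift ψ) = ψ := by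
  funext g
  simp

/-- (Ported verbatim from the HodgeCMPerL package; no docstring in the source.) -/
theorem rTransl_lift (h : U21) (ψ : U21 → (Fin 2 → ℂ)) :
    rTransl h (lift ψ) = lift (lTransl h⁻¹ ψ) := by
  funext x
  simp [mul_assoc]

/-- (Ported verbatim from the HodgeCMPerL package; no docstring in the source.) -/
theorem witness_leftInvariant : witness.D.LeftInvariant := by
  intro i χ F hF γ hγ x
  obtain ⟨ψ, -, rfl⟩ := Submodule.mem_map.mp hF
  have hγ' : γ.2.2 = γ.1 := hγ
  show ψ ((γ.2.2 * x.2.2)⁻¹ * (γ.1 * x.1)) = ψ (x.2.2⁻¹ * x.1)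
  rw [hγ', mul_inv_rev, mul_assoc, inv_mul_cancel_left]

/-- (Ported verbatim from the HodgeCMPerL package; no docstring in the source.) -/
theorem witness_compactInvariant : witness.D.CompactInvariant := by
  intro i χ F hF g c k
  obtain ⟨ψ, -, rfl⟩ := Submodule.mem_map.mp hF
  rfl

/-- (Ported verbatim from the HodgeCMPerL package; no docstring in the source.) -/
theorem witness_finiteStable : witness.D.FiniteStable := by
  intro i χ h F hF
  obtain ⟨ψ, hψ, rfl⟩ := Submodule.mem_map.mp hF
  rw [rTransl_lift]
  exact Submodule.mem_map.mpr ⟨lTransl h⁻¹ ψ, lTransl_mem_holSub h⁻¹ hψ, rfl⟩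

/-- (Ported verbatim from the HodgeCMPerL package; no docstring in the source.) -/
theorem witness_uHolomorphic : witness.D.UHolomorphic := by
  intro i χ F hF
  obtain ⟨ψ, hψ, rfl⟩ := Submodule.mem_map.mp hF
  rw [uEval_lift]
  exact hψ

/-- The constant form `e₀` on the ball and its frame reading, a non-zero element of `Hol`. -/
def u₀ : Ball → (Fin 2 → ℂ) := fun _ => ![1, 0]

/-- (Ported verbatim from the HodgeCMPerL package; no docstring in the source.) -/
theorem R_u₀_mem : R u₀ ∈ holSub := ⟨continuous_R continuous_const, isFrameFn_R u₀⟩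

/-- (Ported verbatim from the HodgeCMPerL package; no docstring in the source.) -/
theorem R_u₀_one : R u₀ 1 = ![1, 0] := by
  rw [R_apply, inv_one, one_smul, A_one]
  rfl

/-- (Ported verbatim from the HodgeCMPerL package; no docstring in the source.) -/
theorem lift_R_u₀_ne_zero : lift (R u₀) ≠ 0 := by
  intro h
  have h1 := congr_fun (congr_fun h ((1 : U21), (), (1 : U21))) 0
  rw [lift_apply, Pi.zero_apply, Pi.zero_apply] at h1
  simp only [inv_one, mul_one, R_u₀_one, Matrix.cons_val_zero] at h1
  exact one_ne_zero h1

/-- (Ported verbatim from the HodgeCMPerL package; no docstring in the source.) -/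
theorem witness_someNonzero : witness.D.SomeNonzero := by
  intro i
  refine ⟨(), fun hbot => lift_R_u₀_ne_zero ?_⟩
  have hmem : lift (R u₀) ∈ witness.D.ThetaP i () := Submodule.mem_map.mpr ⟨R u₀, R_u₀_mem, rfl⟩
  rw [hbot] at hmem
  exact (Submodule.mem_bot ℂ).mp hmem

/-- (Ported verbatim from the HodgeCMPerL package; no docstring in the source.) -/
theorem witness_holFrame : HolFrame witness := fun _ hφ => hφ

/-- (Ported verbatim from the HodgeCMPerL package; no docstring in the source.) -/
theorem witness_holFromBall : witness.HolFromBall := holFromBall_of_frame witness witness_holFrame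

/-- (Ported verbatim from the HodgeCMPerL package; no docstring in the source.) -/
theorem witness_Δ_eq_top : witness.Δ = ⊤ := by
  refine top_unique fun g _ => ?_
  exact Subgroup.mem_map.mpr ⟨(g, (), g), rfl, rfl⟩

/-- (Ported verbatim from the HodgeCMPerL package; no docstring in the source.) -/
theorem witness_dense : Dense (witness.Δ : Set U21) := by
  rw [witness_Δ_eq_top, Subgroup.coe_top]
  exact dense_univ

/-- **The seam-S1 constructor fires on the witness**: pv03's ball-level `N33c_statement` for the witness's spans. -/
theorem smoke_n33c : N33c_statement witness.Δ A (witness.gen 0) (witness.gen 1) :=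
  witness.n33c_ball witness_leftInvariant witness_compactInvariant witness_finiteStable witness_uHolomorphic
    witness_someNonzero witness_holFromBall

/-- **Joint satisfiability of the non-dictionary inputs of `BallSpanStepsInput`.** -/
theorem s1_inputs_satisfiable :
    ∃ S : LineSpans, S.D.LeftInvariant ∧ S.D.CompactInvariant ∧ S.D.FiniteStable ∧ S.D.UHolomorphic ∧
      S.D.SomeNonzero ∧ HolFrame S ∧ S.HolFromBall ∧ Dense (S.Δ : Set U21) ∧
      N33c_statement S.Δ A (S.gen 0) (S.gen 1) :=
  ⟨witness, witness_leftInvariant, witness_compactInvariant, witness_finiteStable, witness_uHolomorphic,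
    witness_someNonzero, witness_holFrame, witness_holFromBall, witness_dense, smoke_n33c⟩

end BallSpansSmoke
end PerL34
end HodgeCM

end
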